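import Summits.ResolutionOfSingularities.ResolutionOfSingularities.Theorems.FrobeniusLadderFRationalResolutionSegreSummand
import Summits.ResolutionOfSingularities.ResolutionOfSingularities.Theorems.FrobeniusLadderFRationalResolutionSegreMemIff
import Summits.ResolutionOfSingularities.ResolutionOfSingularities.Theorems.FrobeniusLadderFRationalResolutionSegreBipartiteSplit
import Summits.ResolutionOfSingularities.ResolutionOfSingularities.Theorems.FrobeniusLadderFRationalResolutionRetractLocalization
import Summits.ResolutionOfSingularities.ResolutionOfSingularities.Theorems.FrobeniusLadderFRationalResolutionRegularRingLocalization
import Summits.ResolutionOfSingularities.ResolutionOfSingularities.Theorems.FrobeniusLadderFRationalResolutionClauseOfRetractRegular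
import Summits.ResolutionOfSingularities.ResolutionOfSingularities.Theorems.FrobeniusLadderFRationalResolutionSpecHypersurface
import Mathlib.RingTheory.RegularLocalRing.Polynomial
import Mathlib.Algebra.CharP.Algebra
import HarnessLib

/-!
# Cone programme: every STALK of the Segre cone `Spec k[xᵢyⱼ]` is a domain with every ideal tightly closed

Support file for crux stmt-ResolutionOfSingularities-15317 (`FrobeniusLadder.FRationalResolution`), line `redirect`,
CONE PROGRAMME (Segre family; stalk form of `segreCone_residualClass`, after the toric template `…ToricClass.lean`).
For every prime `p`, every field `k` of characteristic `p` and all `a, b`: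
* `segreCone_localization_clause` — every local ring `SR[a,b]_P` of the Segre ring `SR[a,b] = k[xᵢyⱼ]` is a domain in
  which EVERY ideal is tightly closed (inline clause of route `FrobeniusLadder`): `SR[a,b]` is a direct summand of
  `k[x,y]` (`stub_segre_retract` over `stub_segre_mem_iff` / `stub_finsupp_bipartite_split`), direct summands localize
  (`stub_retract_localization`), localizations of the regular domain `k[x,y]` are regular domains
  (`stub_isRegularRing_localization`), and Hochster–Huneke 1990 Prop. 4.12 (`stub_clause_of_retract_regular`);
* `segreCone_stalk_clause` — the same for the stalks of `Spec SR[a,b]` (`Spec.stalkIso`, `allIdeals_clause_of_ringEquiv`);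
* `segreCone_fRationalHypothesis` — in particular the crux's literal F-rational stalk hypothesis `hFR` holds at every
  point of the Segre cone (which has a resolution of singularities by `hasResolution_segreCone`, p795206).
[folklore; HochsterHuneke1990 Prop. 4.12; BrunsHerzog1998 §6.1] -/

-- single-problem summit: the doubled namespace component is forced
set_option linter.dupNamespace false

noncomputable section

namespace Summit.ResolutionOfSingularities.ResolutionOfSingularities.Theorems.FRationalResolution

open MvPolynomial AlgebraicGeometry
open Literature.AlgebraicGeometry.Resolution

section Cones

variable (k : Type) [Field k]

/-- The polynomial ring in two blocks of `a` and `b` variables `xᵢ = X (inl i)`, `yⱼ = X (inr j)`. -/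
local notation3 "SP[" a ", " b "]" => MvPolynomial (Fin a ⊕ Fin b) k

/-- The Segre ring `k[xᵢyⱼ] ⊆ k[x, y]`: coordinate ring of the affine cone over the Segre embedding of
`ℙᵃ⁻¹ × ℙᵇ⁻¹`. -/
local notation3 "SR[" a ", " b "]" =>
  Algebra.adjoin k (Set.range (fun ij : Fin a × Fin b =>
    (MvPolynomial.X (Sum.inl ij.1) * MvPolynomial.X (Sum.inr ij.2) : MvPolynomial (Fin a ⊕ Fin b) k)))

/-- **Every local ring of the Segre ring is a domain with EVERY ideal tightly closed** (inline weakly-F-regular clause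
of rung 4′). Direct summand of `k[x,y]` ⇒ localized direct summand of a localization of `k[x,y]`, a regular domain of
characteristic `p`; conclude with Hochster–Huneke 1990 Prop. 4.12. [folklore; HochsterHuneke1990 Prop. 4.12] -/
theorem segreCone_localization_clause (p : ℕ) [Fact p.Prime] [CharP k p] (a b : ℕ)
    (P : Ideal ↥SR[a, b]) [P.IsPrime] :
    IsDomain (Localization.AtPrime P) ∧ ∀ I : Ideal (Localization.AtPrime P),
      ∀ y c : Localization.AtPrime P, c ≠ 0 →
      (∀ e : ℕ, c * y ^ p ^ e ∈ Ideal.span ((fun z : Localization.AtPrime P => z ^ p ^ e) ''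
        (I : Set (Localization.AtPrime P)))) → y ∈ I := by
  obtain ⟨ρ, h1, h2⟩ := stub_segre_retract k a b
    (stub_segre_mem_iff k a b (fun s d h₁ h₂ => stub_finsupp_bipartite_split s d h₁ h₂))
  -- the inclusion `Λ : SR[a,b] → k[x,y]` with its retraction `ρ`
  let Λ : ↥SR[a, b] →+* SP[a, b] := (SR[a, b]).val.toRingHom
  have hΛ : Function.Injective Λ := Subtype.val_injective
  have h1Λ : ∀ t, ρ (Λ t) = t := h1
  have h2Λ : ∀ t g, ρ (Λ t * g) = t * ρ g := h2
  obtain ⟨Λ', ρ', hΛ', h1', h2', -⟩ := stub_retract_localization Λ ρ hΛ h1Λ h2Λ P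
  -- the big ring `S_T`, `S = k[x,y]`, `T = Λ(SR[a,b] ∖ P)`: a regular domain of characteristic `p`
  have hT : P.primeCompl.map Λ ≤ nonZeroDivisors SP[a, b] := by
    rintro _ ⟨u, hu, rfl⟩
    refine mem_nonZeroDivisors_of_ne_zero fun h0 => hu ?_
    have hu0 : u = 0 := hΛ (by rw [h0, map_zero])
    rw [hu0]; exact P.zero_mem
  haveI : IsDomain (Localization (P.primeCompl.map Λ)) := IsLocalization.isDomain_localization hT
  haveI : IsRegularRing (Localization (P.primeCompl.map Λ)) := stub_isRegularRing_localization _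
  haveI : CharP (Localization (P.primeCompl.map Λ)) p := by
    refine charP_of_injective_ringHom (f := (algebraMap SP[a, b] (Localization (P.primeCompl.map Λ))).comp
      (algebraMap k SP[a, b])) ?_ p
    exact (IsLocalization.injective (Localization (P.primeCompl.map Λ)) hT).comp (algebraMap k SP[a, b]).injective
  exact stub_clause_of_retract_regular p Λ' ρ' hΛ' h1' h2'

/-- **Every stalk of the Segre cone `Spec SR[a,b]` is a domain with every ideal tightly closed**
(`Spec.stalkIso` + transport of the clause along ring isomorphisms). [folklore] -/
theorem segreCone_stalk_clause (p : ℕ) [Fact p.Prime] [CharP k p] (a b : ℕ) (z : Spec (CommRingCat.of ↥SR[a, b])) :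
    IsDomain ((Spec (CommRingCat.of ↥SR[a, b])).presheaf.stalk z) ∧
      ∀ I : Ideal ((Spec (CommRingCat.of ↥SR[a, b])).presheaf.stalk z),
      ∀ y c : (Spec (CommRingCat.of ↥SR[a, b])).presheaf.stalk z, c ≠ 0 →
      (∀ e : ℕ, c * y ^ p ^ e ∈ Ideal.span ((fun w : (Spec (CommRingCat.of ↥SR[a, b])).presheaf.stalk z =>
        w ^ p ^ e) '' (I : Set ((Spec (CommRingCat.of ↥SR[a, b])).presheaf.stalk z)))) → y ∈ I := by
  obtain ⟨hdom, hcl⟩ := segreCone_localization_clause k p a b z.asIdeal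
  -- transport along the stalk isomorphism `𝒪_{Spec R, z} ≅ R_{𝔭_z}` (as in `domain_allIdeals_clause_of_iso`)
  exact ⟨MulEquiv.isDomain _ (Spec.stalkIso (CommRingCat.of ↥SR[a, b]) z).commRingCatIsoToRingEquiv.toMulEquiv,
    allIdeals_clause_of_ringEquiv p (Spec.stalkIso (CommRingCat.of ↥SR[a, b]) z).commRingCatIsoToRingEquiv hcl⟩

/-- **THE CRUX'S F-RATIONAL STALK HYPOTHESIS HOLDS ON EVERY SEGRE CONE**: for every point `z` of `Spec k[xᵢyⱼ]` the
stalk is a domain and every ideal generated by a system of parameters (indeed every ideal) is tightly closed — the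
literal shape of the hypothesis `hFR` of `FRationalResolution` / of the registered stubs `stub_spreadOut`,
`stub_isolatedFRegularization`. With `hasResolution_segreCone` the conclusion holds too. [folklore] -/
theorem segreCone_fRationalHypothesis (p : ℕ) [Fact p.Prime] [CharP k p] (a b : ℕ)
    (z : Spec (CommRingCat.of ↥SR[a, b])) :
    IsDomain ((Spec (CommRingCat.of ↥SR[a, b])).presheaf.stalk z) ∧
      ∀ d : ℕ, ringKrullDim ((Spec (CommRingCat.of ↥SR[a, b])).presheaf.stalk z) = d →
      ∀ s : Fin d → (Spec (CommRingCat.of ↥SR[a, b])).presheaf.stalk z,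
        (Ideal.span (Set.range s)).radical.IsMaximal →
      ∀ y c : (Spec (CommRingCat.of ↥SR[a, b])).presheaf.stalk z, c ≠ 0 →
      (∀ e : ℕ, c * y ^ p ^ e ∈ Ideal.span ((fun w : (Spec (CommRingCat.of ↥SR[a, b])).presheaf.stalk z =>
        w ^ p ^ e) '' (Ideal.span (Set.range s) : Set ((Spec (CommRingCat.of ↥SR[a, b])).presheaf.stalk z)))) →
      y ∈ Ideal.span (Set.range s) := by
  obtain ⟨hdom, hcl⟩ := segreCone_stalk_clause k p a b z
  exact ⟨hdom, fun _ _ s _ y c hc hmem => hcl _ y c hc hmem⟩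

end Cones

end Summit.ResolutionOfSingularities.ResolutionOfSingularities.Theorems.FRationalResolution

end
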